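import Summits.ResolutionOfSingularities.ResolutionOfSingularities.Theorems.MarkedTransferCampaignW46WWalkND
import Summits.ResolutionOfSingularities.ResolutionOfSingularities.Theorems.MarkedTransferCampaignW46MohWindowSurface
import Summits.ResolutionOfSingularities.ResolutionOfSingularities.Theorems.WildConesCampaignW46AtomChartOrder
import HarnessLib

/-!
# [OURS · L1 W4.6 rung (iii-2)] THE W-WALK: the regime AT A THREAD POINT read through a `w`-anchor — window bounds, (ND), and the
# cleaning data of an uncleaned child

Cell `res-hironaka`, LADDER-RESOLUTION rung L (D-0089), slot W4.6 rung (iii); seat res-L1-s46-pv-5 (gen 6), plan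
`HOME/L/res-L1-s46-pv-5/W-WALK-PLAN.md` §5 (F4). Host route MarkedTransfer, `--supports stmt-ResolutionOfSingularities-16155 --as helper`;
kind proof (def-free).

WHAT (ring level; `R` a Noetherian local DOMAIN — a stalk of an ambient datum —, `e : R̂ ≃+* K⟦t,y,z⟧` any Cohen coordinates, a `w`-anchor
`e(f₀) = w · (z^p + f)` of a generator `f₀` of `J`, and o1's coefficient presentation `MohWindowSurfaceCoeffAt p R J`):
* `exists_presentation_of_coeffAt` — the presentation `z^p + f = u · (z₂^p + Σ a_i x₂^{d₂−i} y₂^i)` in `K⟦t,y,z⟧` with the hypotheses of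
  `…WWalkND.ndz_of_presentation` (`t, y ∈ (x₂, y₂, z₂)`, `p+1 ≤ d₂ ≤ 2p−1`, a unit coefficient);
* `window_and_ndz_of_wAnchor` — for a CLEANED residual (`ord f ≥ p+1`): `∃ d₂ ∈ [p+1, 2p−1]`, all monomials of `f` of degree `< d₂` with
  `z`-exponent `< p` vanish, and `NDz d₂ f`;
* `cleaningData_of_wAnchor` — for an UNCLEANED residual (`ord f ≥ p`, no `z^p`, no `y^p`): its degree-`p` part is `β′^p t^p`
  (`…WWalkCompare.degree_p_coeff_of_presentation`).

HONEST FRAMING. OURS; nothing here is a statement of H. Hironaka's manuscript [Hironaka2017] and nothing of it is used. AI-written;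
AI review is weaker than expert review. No `sorry`; axioms standard. [cite: Matsumura1987, Thm. 8.11] (faithful flatness of completion).
-/

noncomputable section

set_option linter.dupNamespace false -- mandated namespace of this single-conjunct summit

open MvPowerSeries IsLocalRing Finset
open Literature.AlgebraicGeometry.Resolution
open Literature.RingTheory.MvPowerSeries.Jets (mem_maximalIdeal_iff_constantCoeff_eq_zero mem_maximalIdeal_pow_iff)

namespace Summit.ResolutionOfSingularities.ResolutionOfSingularities.Theorems

namespace CampaignW46

namespace WWalk

open CampaignW46.FormalChart (ringEquiv_mem_maximalIdeal)

variable {p : ℕ} [hp : Fact p.Prime] {K : Type} [Field K] [CharP K p]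
  {R : Type} [CommRing R] [IsLocalRing R] [IsNoetherianRing R] [IsDomain R]

omit hp [CharP K p] in
/-- **o1's coefficient presentation read through a `w`-anchor.** [cite: Matsumura1987, Thm. 8.11] -/
theorem exists_presentation_of_coeffAt {J : Ideal R} (hJ : MohWindowSurfaceCoeffAt p R J)
    (e : AdicCompletion (maximalIdeal R) R ≃+* MvPowerSeries (Option (Fin 2)) K) {f₀ : R} (hf₀ : J = Ideal.span {f₀})
    {w : MvPowerSeries (Option (Fin 2)) K} (hw : IsUnit w) {f : MvPowerSeries (Option (Fin 2)) K}
    (he : e (algebraMap R _ f₀) = w * (X none ^ p + f)) :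
    ∃ (u x₂ y₂ z₂ : MvPowerSeries (Option (Fin 2)) K) (a : ℕ → MvPowerSeries (Option (Fin 2)) K) (d₂ : ℕ),
      constantCoeff u ≠ 0 ∧ constantCoeff x₂ = 0 ∧ constantCoeff y₂ = 0 ∧ constantCoeff z₂ = 0 ∧
      (∃ r s v : MvPowerSeries (Option (Fin 2)) K, (X (some 0) : MvPowerSeries (Option (Fin 2)) K) = r * x₂ + s * y₂ + v * z₂) ∧
      (∃ r s v : MvPowerSeries (Option (Fin 2)) K, (X (some 1) : MvPowerSeries (Option (Fin 2)) K) = r * x₂ + s * y₂ + v * z₂) ∧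
      p + 1 ≤ d₂ ∧ d₂ + 1 ≤ 2 * p ∧ (∃ i, i ≤ d₂ ∧ constantCoeff (a i) ≠ 0) ∧
      X none ^ p + f = u * (z₂ ^ p + ∑ i ∈ range (d₂ + 1), a i * x₂ ^ (d₂ - i) * y₂ ^ i) := by
  classical
  obtain ⟨-, -, x, y, z, hxyz, d, a, hbd, hd2b, ⟨j, hj, hunit⟩, hJeq⟩ := hJ
  set ofR := algebraMap R (AdicCompletion (maximalIdeal R) R) with hofR
  set F : R := ∑ i ∈ range (d + 1), a i * x ^ (d - i) * y ^ i with hF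
  -- `f₀` and `z^p + F` are associated
  have hassoc : Associated (z ^ p + F) f₀ := by
    rw [← Ideal.span_singleton_eq_span_singleton, ← hJeq, hf₀]
  obtain ⟨v, hv⟩ := hassoc
  -- images
  set φ : R →+* MvPowerSeries (Option (Fin 2)) K := (e : _ →+* MvPowerSeries (Option (Fin 2)) K).comp ofR with hφ
  have hφapp : ∀ r : R, φ r = e (ofR r) := fun r => rfl
  have hmem𝔪 : ∀ r : R, r ∈ maximalIdeal R → constantCoeff (φ r) = 0 := by
    intro r hr
    refine mem_maximalIdeal_iff_constantCoeff_eq_zero.mp (ringEquiv_mem_maximalIdeal e ?_)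
    rw [AdicCompletion.maximalIdeal_eq_map]
    exact Ideal.mem_map_of_mem _ hr
  have hx𝔪 : x ∈ maximalIdeal R := by rw [← hxyz]; exact Ideal.subset_span (by simp)
  have hy𝔪 : y ∈ maximalIdeal R := by rw [← hxyz]; exact Ideal.subset_span (by simp)
  have hz𝔪 : z ∈ maximalIdeal R := by rw [← hxyz]; exact Ideal.subset_span (by simp)
  obtain ⟨wu, hwu⟩ := hw
  have hmapeq : (maximalIdeal R).map ofR = Ideal.span (insert (ofR x) (insert (ofR y) {ofR z})) := by
    have h := Ideal.map_span ofR ({x, y, z} : Set R)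
    rw [hxyz, Set.image_insert_eq, Set.image_insert_eq, Set.image_singleton] at h
    exact h
  refine ⟨((wu⁻¹ : (MvPowerSeries (Option (Fin 2)) K)ˣ) : MvPowerSeries (Option (Fin 2)) K) * φ v, φ x, φ y, φ z, fun i => φ (a i), d, ?_,
    hmem𝔪 x hx𝔪, hmem𝔪 y hy𝔪, hmem𝔪 z hz𝔪, ?_, ?_, by omega, by omega, ⟨j, hj, ?_⟩, ?_⟩
  · -- `u` is a unit
    have hu : IsUnit (((wu⁻¹ : (MvPowerSeries (Option (Fin 2)) K)ˣ) : MvPowerSeries (Option (Fin 2)) K) * φ v) :=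
      (Units.isUnit _).mul ((Units.isUnit v).map φ)
    exact fun h0 => (MvPowerSeries.isUnit_iff_constantCoeff.mp hu).ne_zero h0
  · -- `X t ∈ (x₂, y₂, z₂)`
    have hXt : e.symm (X (some 0)) ∈ (maximalIdeal R).map ofR := by
      rw [← AdicCompletion.maximalIdeal_eq_map]
      exact ringEquiv_mem_maximalIdeal e.symm (mem_maximalIdeal_iff_constantCoeff_eq_zero.mpr (constantCoeff_X _))
    rw [hmapeq] at hXt
    obtain ⟨r, q, hq, hrq⟩ := Ideal.mem_span_insert.mp hXt
    obtain ⟨s, q', hq', hsq⟩ := Ideal.mem_span_insert.mp hq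
    obtain ⟨v', hv'⟩ := Ideal.mem_span_singleton'.mp hq'
    refine ⟨e r, e s, e v', ?_⟩
    have := congrArg e hrq
    rw [RingEquiv.apply_symm_apply, hsq, ← hv'] at this
    rw [this, map_add, map_add, map_mul, map_mul, map_mul, hφapp, hφapp, hφapp, add_assoc]
  · have hXy : e.symm (X (some 1)) ∈ (maximalIdeal R).map ofR := by
      rw [← AdicCompletion.maximalIdeal_eq_map]
      exact ringEquiv_mem_maximalIdeal e.symm (mem_maximalIdeal_iff_constantCoeff_eq_zero.mpr (constantCoeff_X _))
    rw [hmapeq] at hXy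
    obtain ⟨r, q, hq, hrq⟩ := Ideal.mem_span_insert.mp hXy
    obtain ⟨s, q', hq', hsq⟩ := Ideal.mem_span_insert.mp hq
    obtain ⟨v', hv'⟩ := Ideal.mem_span_singleton'.mp hq'
    refine ⟨e r, e s, e v', ?_⟩
    have := congrArg e hrq
    rw [RingEquiv.apply_symm_apply, hsq, ← hv'] at this
    rw [this, map_add, map_add, map_mul, map_mul, map_mul, hφapp, hφapp, hφapp, add_assoc]
  · -- the unit coefficient
    exact fun h0 => (MvPowerSeries.isUnit_iff_constantCoeff.mp (hunit.map φ)).ne_zero h0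
  · -- the identity
    have h1 : φ f₀ = φ (z ^ p + F) * φ v := by rw [← map_mul, hv]
    have h2 : φ f₀ = w * (X none ^ p + f) := he
    have h3 : φ (z ^ p + F) = φ z ^ p + ∑ i ∈ range (d + 1), φ (a i) * φ x ^ (d - i) * φ y ^ i := by
      rw [map_add, map_pow, hF, map_sum]
      refine congrArg _ (sum_congr rfl fun i _ => ?_)
      rw [map_mul, map_mul, map_pow, map_pow]
    have h4 : X none ^ p + f = ((wu⁻¹ : (MvPowerSeries (Option (Fin 2)) K)ˣ) : MvPowerSeries (Option (Fin 2)) K) * φ f₀ := by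
      rw [h2, ← hwu, ← mul_assoc, Units.inv_mul, one_mul]
    rw [h4, h1, h3]
    ring

/-- Window bounds and (ND) for a CLEANED residual at a point of o1's regime. [cite: Matsumura1987, Thm. 8.11] -/
theorem window_and_ndz_of_wAnchor {J : Ideal R} (hJ : MohWindowSurfaceCoeffAt p R J)
    (e : AdicCompletion (maximalIdeal R) R ≃+* MvPowerSeries (Option (Fin 2)) K) {f₀ : R} (hf₀ : J = Ideal.span {f₀})
    {w : MvPowerSeries (Option (Fin 2)) K} (hw : IsUnit w) {f : MvPowerSeries (Option (Fin 2)) K}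
    (he : e (algebraMap R _ f₀) = w * (X none ^ p + f)) (hfP2 : LowVanish (p + 1) f) :
    ∃ d₂, p + 1 ≤ d₂ ∧ d₂ + 1 ≤ 2 * p ∧ (∀ a' b c, a' + b + c < d₂ → c < p → coeff (mk3 a' b c) f = 0) ∧ NDz d₂ f := by
  obtain ⟨u, x₂, y₂, z₂, a, d₂, hu, hx, hy, hz, hspanT, hspanY, hd₂, hd₂', ha, hg⟩ := exists_presentation_of_coeffAt hJ e hf₀ hw he
  exact ⟨d₂, hd₂, hd₂', ndz_of_presentation hu hx hy hz hspanT hspanY hd₂ hd₂' ha hfP2 hg⟩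

/-- **Cleaning data of an UNCLEANED child residual** at a point of o1's regime: if `ord f ≥ p` and the coefficients of `z^p` and `y^p` in
`f` vanish, then all degree-`p` monomials of `f` other than `t^p` vanish and the coefficient of `t^p` is a `p`-th power.
[cite: Matsumura1987, Thm. 8.11] -/
theorem cleaningData_of_wAnchor {J : Ideal R} (hJ : MohWindowSurfaceCoeffAt p R J)
    (e : AdicCompletion (maximalIdeal R) R ≃+* MvPowerSeries (Option (Fin 2)) K) {f₀ : R} (hf₀ : J = Ideal.span {f₀})
    {w : MvPowerSeries (Option (Fin 2)) K} (hw : IsUnit w) {f : MvPowerSeries (Option (Fin 2)) K}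
    (he : e (algebraMap R _ f₀) = w * (X none ^ p + f)) (hfz : coeff (mk3 0 0 p) f = 0) (hfy : coeff (mk3 0 p 0) f = 0) :
    (∀ a b cz, a + b + cz = p → a ≠ p → coeff (mk3 a b cz) f = 0) ∧ ∃ β' : K, coeff (mk3 p 0 0) f = β' ^ p := by
  classical
  obtain ⟨u, x₂, y₂, z₂, a, d₂, hu, hx, hy, hz, -, -, hd₂, -, -, hg⟩ := exists_presentation_of_coeffAt hJ e hf₀ hw he
  set h := u * ∑ i ∈ range (d₂ + 1), a i * x₂ ^ (d₂ - i) * y₂ ^ i with hh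
  have hg' : X none ^ p + f = u * z₂ ^ p + h := by rw [hg, mul_add]
  have hhmem : h ∈ maximalIdeal (MvPowerSeries (Option (Fin 2)) K) ^ (p + 1) := by
    refine Ideal.pow_le_pow_right hd₂ (Ideal.mul_mem_left _ _ (Ideal.sum_mem _ fun i hi => ?_))
    rw [mem_range] at hi
    rw [mul_assoc]
    refine Ideal.mul_mem_left _ _ ?_
    have h1 := Ideal.mul_mem_mul (Ideal.pow_mem_pow (mem_maximalIdeal_iff_constantCoeff_eq_zero.mpr hx) (d₂ - i))
      (Ideal.pow_mem_pow (mem_maximalIdeal_iff_constantCoeff_eq_zero.mpr hy) i)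
    rwa [← pow_add, show d₂ - i + i = d₂ by omega] at h1
  have hhlow : LowVanish (p + 1) h := mem_maximalIdeal_pow_iff.mp hhmem
  obtain ⟨hall, ⟨β', hβ'⟩, -⟩ := degree_p_coeff_of_presentation hz hfz hhlow hg'
  refine ⟨fun a' b cz habc ha' => ?_, β', hβ'⟩
  by_cases hb : b = p
  · have : a' = 0 ∧ cz = 0 := by omega
    rw [this.1, this.2, hb]; exact hfy
  · exact hall a' b cz habc ha' hb

end WWalk

end CampaignW46

end Summit.ResolutionOfSingularities.ResolutionOfSingularities.Theorems

end
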